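import Literature.Computability.MetaComplexity.LanguageCompressionTest
import Literature.Computability.MetaComplexity.LanguageCompressionClaim
import Literature.Computability.MetaComplexity.ParamUniformHeuristics
import Literature.Computability.MetaComplexity.UniversalHeuristicSchemesProofs
import Literature.Computability.Complexity.FinitePatching
import HarnessLib

/-!
# Complexity meta: Thm. 4.2 of Hirahara 2021 (algorithmic language compression) from Lemma 3.4, Thm. 3.12 and Lemma 4.5

Topic `Literature/Computability/MetaComplexity`. The named fact `Hirahara2021_languageCompression`
(`LanguageCompression.lean`; S. Hirahara, *Average-case hardness of NP from exponential worst-case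
hardness assumptions*, ECCC TR21-058 (2021), Thm. 4.2) PROVED relative to the three results of §3–§4 its
printed proof (pp. 27–29) invokes and that are not Hirahara's Thm. 4.2-specific arguments, each stated
inline as a hypothesis in the form in which the proof uses it (no new named facts, D-0026):

* `h34` — **Lemma 3.4** (the Buhrman–Fortnow–Pavan pseudorandom generator from the hypothesis
  `coNP × {U, T} ⊆ Avg¹_{1-n^{-c}} P`) in the promise form "`pr-BPP = pr-P` by Lemma 3.4" (p. 27, p. 29;
  the hypothesis `h34` of `UPSearchAssembly.lean`);
* `h312K` — **Thm. 3.12** (reconstruction for `DP_k`) in its Kolmogorov form "In particular,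
  `K^{p(ns/ε)}(x | D) ≤ k + log p(ns/ε)`" (p. 23), for the polynomial-time tests with unary parameter
  `w ↦ [(w, 1^m) ∈ D₀]`, `D₀ ∈ P` (the description of the test, `m`, charged inside the polynomial);
* `h45` — **Lemma 4.5** ("there exists a polynomial-time algorithm that, on input `1ᵗ`, outputs `v`
  with `|L_t| ≤ v ≤ 4|L_t|`", p. 26) in the form the proof consumes: a polynomial-time unary log-size
  estimator `κ` with `|L_t| ≤ 2^{κ(t)}` and `κ(t) ≤ log|L_t| + 3` for all large `t` (from `v`:
  `κ := ⌊log v⌋ + 1`). It is itself proved in print from Lemma 3.4, Lemma 3.6 and the Goldwasser–Sipser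
  protocol and is discharged in a sequel file; here it is an explicit hypothesis.

Everything else in the printed proof is formalised: Lemma 3.6 (generator-free, via `pr-coRP ⊆ pr-P`:
`ParamUniform.exists_heuristic_paramUniform`), `L' ∈ NP` and Eq. (6) (`LanguageCompressionNP.lean`), the
test `B'` (`LanguageCompressionTest.lean`), Claim 4.7 (`LanguageCompressionClaim.lean`), the choice of
`k(t) = κ(t) + Λ(t)` and of the final polynomial `p` (`LanguageCompressionBounds.lean`, `log_poly_ge`),
"`Π ∈ pr-coRP`; using Lemma 3.4, `Π ∈ pr-BPP = pr-P`" (`mem_PromiseP_of_weak_coRP`), and the finitely many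
small `t` ("for all large `t`", handled by finite patching, `mem_FP_of_eqOn_le`, the polynomial `p`
being taken `≥ 2^{C+4}` so that no small yes-instance is a no-instance).

Main result: `Hirahara2021_languageCompression_of_lemmas`.

## References

* S. Hirahara, ECCC TR21-058 (2021): Thm. 4.2 and its proof, Claim 4.7 (pp. 26–29); Lemma 3.4 (p. 20),
  Lemma 3.6 (p. 21), Thm. 3.12 (p. 23), Lemma 4.5 (p. 26) [Hirahara2021].
-/

noncomputable section

namespace Literature.Computability.MetaComplexity

open _root_.Computability Polynomial Complexity Complexity.Classes Complexity.Nondeterministic Complexity.Brick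
  Complexity.Plumb Complexity.HashBricks Complexity.LenCmp

namespace LCAssembly

open LCTest LCClaim

/-! ### The large-`t` promise problem and its `pr-coRP` witness -/

section Witness

variable (U : UniversalMachine) (L : Language Bool) (p : ℕ → ℕ) (pL : Polynomial ℕ) (T₀ : ℕ)

/-- The promise problem of Thm. 4.2 restricted to large `t` and short `x`: YES `(x, 1ᵗ)` with
`t ≥ T₀`, `x ∈ L_t`; NO `(x, 1ᵗ)` with `t ≥ T₀`, `|x| ≤ p_L(t)` and `K^{p(t)}(x) > log|L_t| + log p(t)`.
[cite: Hirahara2021, Thm. 4.2 (proof, Claim 4.7: "For all large t and every n ≤ p_L(t)")] -/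
def largeProblem : PromiseProblem where
  yes := {v | ∃ (x : List Bool) (t : ℕ), v = paramEnc (x, t) ∧ T₀ ≤ t ∧ x ∈ languageSlice L t}
  no := {v | ∃ (x : List Bool) (t : ℕ), v = paramEnc (x, t) ∧ T₀ ≤ t ∧ x.length ≤ pL.eval t ∧
    ((Nat.log 2 (languageSlice L t).ncard + Nat.log 2 (p t) : ℕ) : ℕ∞) < U.ktAt (p t) x}

end Witness

/-! ### The assembly -/

/-- **Hirahara 2021, Thm. 4.2, from Lemma 3.4 (promise form), Thm. 3.12 (`K`-form) and Lemma 4.5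
(log-size estimator form).** See the module docstring for the three hypotheses; the conclusion is the
named fact `Hirahara2021_languageCompression` verbatim.
[cite: Hirahara2021, Thm. 4.2 (proof, pp. 27–29)] -/
theorem Hirahara2021_languageCompression_of_lemmas
    (h34 : (∃ c : ℕ, distClass coNP {uniformEnsemble, tallyEnsemble} ⊆
        Avg1DeltaP fun n => 1 - 1 / (n : ℝ) ^ c) → PromiseBPP' ⊆ PromiseP)
    (h312K : ∀ U : UniversalMachine,
      (∃ c : ℕ, distClass coNP {uniformEnsemble, tallyEnsemble} ⊆ Avg1DeltaP fun n => 1 - 1 / (n : ℝ) ^ c) →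
        ∀ D₀ : Language Bool, D₀ ∈ Classes.P → ∃ q : Polynomial ℕ,
          ∀ (x : List Bool) (m k e : ℕ), 1 ≤ e →
            1 / (e : ℝ) ≤ dpAdvantage k x (fun w => D₀.boolIndicator (paramEnc (w, m))) →
              U.ktAt (q.eval (x.length + k + e + m)) x ≤
                ((k + Nat.log 2 (q.eval (x.length + k + e + m)) : ℕ) : ℕ∞))
    (h45 : (∃ c : ℕ, distClass coNP {uniformEnsemble, tallyEnsemble} ⊆ Avg1DeltaP fun n => 1 - 1 / (n : ℝ) ^ c) →
      ∀ L : Language Bool, L ∈ NP → IsLanguageEnsemble L →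
        ∃ κU : List Bool → List Bool, κU ∈ FP ∧ ∃ t₁ : ℕ, ∀ t : ℕ, t₁ ≤ t →
          (languageSlice L t).ncard ≤ 2 ^ (κU (unaryEncodeNat t)).length ∧
            (κU (unaryEncodeNat t)).length ≤ Nat.log 2 (languageSlice L t).ncard + 3) :
    Hirahara2021_languageCompression := by
  intro U hyp L hL hens
  have hD : PromiseBPP' ⊆ PromiseP := h34 hyp
  obtain ⟨pL, hpL⟩ := id hens
  -- Lemma 4.5: the log-size estimator
  obtain ⟨κU, hκ, t₁, hκspec⟩ := h45 hyp L hL hens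
  -- Lemma 3.6 for `L' = dpLang L`
  obtain ⟨D₀, hD₀P, q₁, hB1, hB2⟩ := ParamUniform.exists_heuristic_paramUniform hyp hD (dpLang_mem_NP hL)
  -- Thm. 3.12 for the test `D₀`
  obtain ⟨q3, hq3⟩ := h312K U hyp D₀ hD₀P
  -- the slack
  obtain ⟨qκ, hqκ'⟩ := exists_poly_length_le_of_mem_FP hκ
  have hqκ : ∀ t, kap κU t ≤ qκ.eval t := fun t => by
    have h := hqκ' (unaryEncodeNat t)
    rwa [show (unaryEncodeNat t).length = t from unary_decode_encode_nat t] at h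
  obtain ⟨E, T₁, hslack⟩ := LCBounds.exists_slack pL qκ q₁
  -- notation
  set k : ℕ → ℕ := kOf κU E with hkdef
  have hk_le : ∀ t, k t ≤ qκ.eval t + E * (t + 3) := fun t =>
    Nat.add_le_add (hqκ t) (lam_le E t)
  -- the polynomial `Wp` bounding `ℓ + m`, and `S` bounding the argument of `q3`
  set Yp : Polynomial ℕ := pL + qκ + X + 4 with hYp
  set Wp : Polynomial ℕ := 5 * (C (E + 2)) ^ 4 * Yp ^ 4 with hWp
  set S : Polynomial ℕ := 2 * Wp + 4 * q₁.comp Wp with hS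
  set Q3 : Polynomial ℕ := q3.comp S with hQ3
  have hWp : ∀ t n, n ≤ pL.eval t → (n + 1) * k t + idx3 n (k t) t ≤ Wp.eval t ∧ n + k t ≤ Wp.eval t := by
    intro t n hn
    have hY : Yp.eval t = pL.eval t + qκ.eval t + t + 4 := by simp [hYp]
    have hn' : n + 1 ≤ Yp.eval t := by rw [hY]; omega
    have ht' : t + 1 ≤ Yp.eval t := by rw [hY]; omega
    have hk' : k t ≤ (E + 1) * Yp.eval t := by
      have := hk_le t
      rw [hY]
      have : E * (t + 3) ≤ E * (pL.eval t + qκ.eval t + t + 4) := Nat.mul_le_mul_left E (by omega)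
      nlinarith
    have h := LCBounds.sample_add_index_le (E := E) hn' hk' ht'
    have hW : Wp.eval t = 5 * (E + 2) ^ 4 * Yp.eval t ^ 4 := by simp [hWp]
    refine ⟨by rw [hW]; exact h, ?_⟩
    rw [hW]
    have h1 : n + k t ≤ (E + 2) * Yp.eval t := by nlinarith
    have hY1 : 1 ≤ Yp.eval t := by omega
    have hY4 : Yp.eval t ≤ Yp.eval t ^ 4 := by
      calc Yp.eval t = Yp.eval t ^ 1 := (pow_one _).symm
        _ ≤ Yp.eval t ^ 4 := Nat.pow_le_pow_right hY1 (by omega)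
    have hE4 : E + 2 ≤ 5 * (E + 2) ^ 4 := by nlinarith [Nat.one_le_pow 3 (E + 2) (by omega)]
    exact h1.trans (Nat.mul_le_mul hE4 hY4)
  -- small instances: `K^{c₀}(x) ≤ |x| + a₀`
  obtain ⟨c₀, a₀, hsmallK⟩ := U.exists_ktAt_le_length_add
  set T₀ := max t₁ T₁ with hT₀
  set nb := 2 * pL.eval T₀ + T₀ + 2 with hnb
  set Cb := nb + a₀ with hCb
  -- the final polynomial `p`
  set pPoly : Polynomial ℕ := Polynomial.C (2 ^ (Cb + 4)) * (2 * (X + 2)) ^ E * (Q3 + Polynomial.C c₀ + 1) with hpPoly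
  set p : ℕ → ℕ := fun t => pPoly.eval t with hp
  have hp_eval : ∀ t, p t = 2 ^ (Cb + 4) * (2 * (t + 2)) ^ E * (Q3.eval t + c₀ + 1) := fun t => by
    simp [hp, hpPoly]
  have hp_ge_Q3 : ∀ t, Q3.eval t ≤ p t := fun t => by
    rw [hp_eval]
    have h1 : 1 ≤ 2 ^ (Cb + 4) * (2 * (t + 2)) ^ E := Nat.one_le_iff_ne_zero.2 (by positivity)
    nlinarith
  have hp_ge_c₀ : ∀ t, c₀ ≤ p t := fun t => by
    rw [hp_eval]
    have h1 : 1 ≤ 2 ^ (Cb + 4) * (2 * (t + 2)) ^ E := Nat.one_le_iff_ne_zero.2 (by positivity)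
    nlinarith
  have hlogp : ∀ t, Cb + 4 + lam E t + Nat.log 2 (Q3.eval t) ≤ Nat.log 2 (p t) := fun t => by
    rw [hp_eval]
    have h := log_poly_ge Cb E t (Q := Q3.eval t + c₀ + 1) (by omega)
    have hmono : Nat.log 2 (Q3.eval t) ≤ Nat.log 2 (Q3.eval t + c₀ + 1) := Nat.log_mono_right (by omega)
    unfold lam
    omega
  refine ⟨pPoly, ?_⟩
  /- ### Claim 4.7 (2): on a large no-instance the test rejects with probability `> s/4` -/
  have claim : ∀ (x : List Bool) (t : ℕ), T₀ ≤ t → x.length ≤ pL.eval t →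
      ((Nat.log 2 (languageSlice L t).ncard + Nat.log 2 (p t) : ℕ) : ℕ∞) < U.ktAt (p t) x →
        1 / (4 * ((q₁.eval (Wp.eval t) : ℕ) : ℝ)) <
          uniformProb (x.length * k t) {z | paramEnc (dpGen (k t) x z, idx3 x.length (k t) t) ∉ D₀} := by
    intro x t ht hxn hno
    set n := x.length with hn
    set ℓ := (n + 1) * k t with hℓ
    set m := idx3 n (k t) t with hm
    have ht₁ : t₁ ≤ t := (le_max_left _ _).trans ht
    have hT₁ : T₁ ≤ t := (le_max_right _ _).trans ht
    obtain ⟨hℓm, hnk⟩ := hWp t n hxn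
    -- success `s = 1/q₁(ℓ + m)` of the heuristic on the slice
    obtain ⟨hq1, hcorr⟩ := hB2 ℓ m
    set s : ℝ := 1 / ((q₁.eval (ℓ + m) : ℕ) : ℝ) with hs
    have hq1pos : (0 : ℝ) < ((q₁.eval (ℓ + m) : ℕ) : ℝ) := by exact_mod_cast hq1
    have hspos : 0 < s := by rw [hs]; positivity
    have hs1 : s ≤ 1 := by rw [hs, div_le_one hq1pos]; exact_mod_cast hq1
    have hℓeq : ℓ = n * k t + k t := by rw [hℓ]; ring
    rw [hℓeq] at hcorr
    -- the slice bound `≤ s/2` from the estimator and the slack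
    have hslack2 : 2 / s ≤ (2 : ℝ) ^ lam E t := by
      have h1 := hslack t n (k t) hT₁ hxn (hk_le t)
      have h2 := pow_le_two_pow_lam E t
      rw [hs, div_div_eq_mul_div, div_one]
      have : ((2 * q₁.eval (ℓ + m) : ℕ) : ℝ) ≤ ((2 ^ lam E t : ℕ) : ℝ) := by
        exact_mod_cast (h1.trans h2)
      push_cast at this
      linarith
    have hslice : uniformProb (n * k t + k t) {w | paramEnc (w, idx3 n (k t) t) ∈ dpLang L} ≤ s / 2 :=
      slice_le_half hens (κ := kap κU t) (Λ := lam E t) rfl (hκspec t ht₁).1 hspos hslack2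
    -- if the test accepted with probability `≥ 1 - s/4`, Thm. 3.12 would compress `x` — contradiction
    by_contra hacc
    push Not at hacc
    have hacc' : 1 - s / 4 ≤ uniformProb (n * k t) {z | paramEnc (dpGen (k t) x z, idx3 n (k t) t) ∈ D₀} := by
      have hcompl : uniformProb (n * k t) {z | paramEnc (dpGen (k t) x z, idx3 n (k t) t) ∈ D₀} =
          1 - uniformProb (n * k t) {z | paramEnc (dpGen (k t) x z, idx3 n (k t) t) ∉ D₀} := by
        rw [show {z | paramEnc (dpGen (k t) x z, idx3 n (k t) t) ∉ D₀} =
          {z | paramEnc (dpGen (k t) x z, idx3 n (k t) t) ∈ D₀}ᶜ from rfl, uniformProb_compl]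
        ring
      have hmono : 1 / (4 * ((q₁.eval (Wp.eval t) : ℕ) : ℝ)) ≤ s / 4 := by
        rw [hs]
        have hle : ((q₁.eval (ℓ + m) : ℕ) : ℝ) ≤ ((q₁.eval (Wp.eval t) : ℕ) : ℝ) := by
          exact_mod_cast LCBounds.eval_mono q₁ hℓm
        rw [div_div]
        exact one_div_le_one_div_of_le (by positivity) (by linarith)
      rw [hcompl]
      linarith
    have hadv := dpAdvantage_ge (D₀ := D₀) (L := L) (x := x) (k := k t) (t := t) hcorr hslice hacc'
    -- Thm. 3.12: `K^{q3(n + k + e + m)}(x) ≤ k + log q3(…)` with `e = 4 q₁(ℓ + m)`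
    set e := 4 * q₁.eval (ℓ + m) with he
    have he1 : 1 ≤ e := by rw [he]; omega
    have hadv' : 1 / (e : ℝ) ≤ dpAdvantage (k t) x fun w => D₀.boolIndicator (paramEnc (w, m)) := by
      have : (1 : ℝ) / e = s / 4 := by rw [he, hs]; push_cast; rw [div_div, mul_comm]
      rw [this]; exact hadv
    have hK := hq3 x m (k t) e he1 hadv'
    -- the argument of `q3` is at most `S(t)`, so `K^{Q3(t)}(x) ≤ k + log Q3(t)`
    have harg : n + k t + e + m ≤ S.eval t := by
      have h1 : e ≤ 4 * q₁.eval (Wp.eval t) := Nat.mul_le_mul_left 4 (LCBounds.eval_mono q₁ hℓm)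
      have h2 : m ≤ Wp.eval t := le_trans (Nat.le_add_left _ _) hℓm
      simp only [hS, eval_add, eval_mul, eval_ofNat, eval_comp]
      omega
    have hQ3ge : q3.eval (n + k t + e + m) ≤ Q3.eval t := by
      rw [hQ3, eval_comp]; exact LCBounds.eval_mono q3 harg
    have hK' : U.ktAt (Q3.eval t) x ≤ ((k t + Nat.log 2 (Q3.eval t) : ℕ) : ℕ∞) :=
      calc U.ktAt (Q3.eval t) x ≤ U.ktAt (q3.eval (n + k t + e + m)) x := U.ktAt_anti hQ3ge x
        _ ≤ ((k t + Nat.log 2 (q3.eval (n + k t + e + m)) : ℕ) : ℕ∞) := hK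
        _ ≤ ((k t + Nat.log 2 (Q3.eval t) : ℕ) : ℕ∞) := by
          exact_mod_cast Nat.add_le_add_left (Nat.log_mono_right hQ3ge) _
    -- `k(t) = κ(t) + Λ(t) ≤ log|L_t| + 3 + Λ(t)`, and `log p(t) ≥ C + 4 + Λ(t) + log Q3(t)`
    have hkbound : k t ≤ Nat.log 2 (languageSlice L t).ncard + 3 + lam E t := by
      have := (hκspec t ht₁).2
      show kap κU t + lam E t ≤ _
      unfold kap; omega
    have hfin : U.ktAt (p t) x ≤ ((Nat.log 2 (languageSlice L t).ncard + Nat.log 2 (p t) : ℕ) : ℕ∞) :=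
      calc U.ktAt (p t) x ≤ U.ktAt (Q3.eval t) x := U.ktAt_anti (hp_ge_Q3 t) x
        _ ≤ ((k t + Nat.log 2 (Q3.eval t) : ℕ) : ℕ∞) := hK'
        _ ≤ ((Nat.log 2 (languageSlice L t).ncard + Nat.log 2 (p t) : ℕ) : ℕ∞) := by
          have := hlogp t
          exact_mod_cast (by omega)
    exact absurd hno (not_lt.2 hfin)
  /- ### `Π ∈ pr-coRP ⊆ pr-P` for large `t` -/
  have hlarge : largeProblem U L p pL T₀ ∈ PromiseP := by
    refine mem_PromiseP_of_weak_coRP hD (testLang_mem_P hκ E hD₀P) (X * (qκ + C E * (X + 3))) (4 * q₁.comp Wp)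
      (fun v hv y hy => ?_) (fun v hv => ?_)
    · -- yes side: `DP_k(x; z) ∈ L'`, and the heuristic accepts all of `L'`
      obtain ⟨x, t, rfl, ht, hx⟩ := hv
      rw [boolPair_mem_testLang_iff]
      refine hB1 _ _ ((paramEnc_mem_dpLang_iff L _ _ _ _).2 ⟨x, y.take (x.length * k t), rfl, ?_, hx, rfl⟩)
      refine List.length_take_of_le ?_
      have hlen : t ≤ (paramEnc (x, t)).length ∧ x.length ≤ (paramEnc (x, t)).length := by
        simp only [paramEnc, length_boolPair, ParamUniform.length_unaryEncodeNat]; omega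
      rw [hy]
      simp only [eval_mul, eval_X, eval_add, Polynomial.eval_C, eval_ofNat]
      have hk1 := hk_le t
      have hk2 : qκ.eval t + E * (t + 3) ≤ qκ.eval (paramEnc (x, t)).length + E * ((paramEnc (x, t)).length + 3) :=
        Nat.add_le_add (LCBounds.eval_mono qκ hlen.1) (Nat.mul_le_mul_left E (by omega))
      exact Nat.mul_le_mul hlen.2 (hk1.trans hk2)
    · -- no side: Claim 4.7 (2)
      obtain ⟨x, t, rfl, ht, hxn, hno⟩ := hv
      have hc := claim x t ht hxn hno
      have hlen : t ≤ (paramEnc (x, t)).length ∧ x.length ≤ (paramEnc (x, t)).length := by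
        simp only [paramEnc, length_boolPair, ParamUniform.length_unaryEncodeNat]; omega
      -- only the prefix `z = y ↾ nk(t)` of the coins matters
      set P := (X * (qκ + C E * (X + 3)) : Polynomial ℕ).eval (paramEnc (x, t)).length with hP
      have hPge : x.length * k t ≤ P := by
        rw [hP]
        simp only [eval_mul, eval_X, eval_add, Polynomial.eval_C, eval_ofNat]
        have hk2 : qκ.eval t + E * (t + 3) ≤ qκ.eval (paramEnc (x, t)).length + E * ((paramEnc (x, t)).length + 3) :=
          Nat.add_le_add (LCBounds.eval_mono qκ hlen.1) (Nat.mul_le_mul_left E (by omega))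
        exact Nat.mul_le_mul hlen.2 ((hk_le t).trans hk2)
      obtain ⟨d, hd⟩ := Nat.exists_eq_add_of_le hPge
      have hset : uniformProb P {y | boolPair (paramEnc (x, t)) y ∉ testLang κU E D₀} =
          uniformProb (x.length * k t) {z | paramEnc (dpGen (k t) x z, idx3 x.length (k t) t) ∉ D₀} := by
        rw [hd, ← ParamUniform.uniformProb_setOf_take (x.length * k t) d]
        refine ParamUniform.uniformProb_congr' fun y _ => ?_
        simp only [Set.mem_setOf_eq, boolPair_mem_testLang_iff]
        rfl
      rw [hset]
      refine le_trans ?_ hc.le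
      have hmono : ((q₁.eval (Wp.eval t) : ℕ) : ℝ) ≤ (((4 * q₁.comp Wp).eval (paramEnc (x, t)).length : ℕ) : ℝ) / 4 := by
        rw [le_div_iff₀ (by norm_num)]
        have : q₁.eval (Wp.eval t) ≤ q₁.eval (Wp.eval (paramEnc (x, t)).length) :=
          LCBounds.eval_mono q₁ (LCBounds.eval_mono Wp hlen.1)
        have h' : ((q₁.eval (Wp.eval t) : ℕ) : ℝ) ≤ ((q₁.eval (Wp.eval (paramEnc (x, t)).length) : ℕ) : ℝ) := by
          exact_mod_cast this
        simp only [eval_mul, eval_ofNat, eval_comp]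
        push_cast
        linarith
      have hq1pos : (0 : ℝ) < ((q₁.eval (Wp.eval t) : ℕ) : ℝ) := by
        have := (hB2 0 (Wp.eval t)).1
        simp only [zero_add] at this
        exact_mod_cast this
      rw [one_div_le_one_div (by positivity) (by positivity)]
      linarith
  obtain ⟨M₁, hM₁P, hyesM, hnoM⟩ := hlarge
  /- ### The final language: finite patching below length `nb` -/
  -- the main language: `|x| ≤ p_L(t)`, `T₀ ≤ t`, and `M₁`
  set lenCond : Language Bool := fanoutFn sndF fstF ⁻¹' LenLe pL with hlenCond
  set tCond : Language Bool := {v | (takeFn ∘ fanoutFn (fun _ => ones T₀) (onesFn ∘ sndF)) v = (fun _ => ones T₀) v}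
    with htCond
  have hlenCondP : lenCond ∈ Classes.P := preimage_mem_P (LenLe_mem_P pL) (fanoutFn_mem_FP sndF_mem_FP fstF_mem_FP)
  have htCondP : tCond ∈ Classes.P :=
    setOf_apply_eq_apply_mem_P (comp_mem_FP takeFn_mem_FP (fanoutFn_mem_FP (const_mem_FP _) (comp_mem_FP onesFn_mem_FP sndF_mem_FP)))
      (const_mem_FP _)
  have hlenCond_iff : ∀ x t, paramEnc (x, t) ∈ lenCond ↔ x.length ≤ pL.eval t := fun x t => by
    change fanoutFn sndF fstF (boolPair x (unaryEncodeNat t)) ∈ LenLe pL ↔ _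
    rw [fanoutFn_apply, sndF_boolPair, fstF_boolPair, boolPair_mem_LenLe, ParamUniform.length_unaryEncodeNat]
  have htCond_iff : ∀ x t, paramEnc (x, t) ∈ tCond ↔ T₀ ≤ t := fun x t => by
    change (takeFn ∘ fanoutFn (fun _ => ones T₀) (onesFn ∘ sndF)) (paramEnc (x, t)) = ones T₀ ↔ _
    simp only [Function.comp_apply, fanoutFn_apply, paramEnc, sndF_boolPair, takeFn_boolPair, onesFn,
      Complexity.unaryEncodeNat_eq_replicate, ones, List.take_replicate, List.length_replicate]
    constructor
    · intro h; have := congr_arg List.length h; simp at this; omega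
    · intro h; rw [Nat.min_eq_left h]
  set Lmain : Language Bool := lenCond ⊓ (tCond ⊓ M₁) with hLmain
  have hLmainP : Lmain ∈ Classes.P := inter_mem_P hlenCondP (inter_mem_P htCondP hM₁P)
  have hLmain_iff : ∀ x t, paramEnc (x, t) ∈ Lmain ↔ x.length ≤ pL.eval t ∧ T₀ ≤ t ∧ paramEnc (x, t) ∈ M₁ := by
    intro x t
    change paramEnc (x, t) ∈ lenCond ∧ (paramEnc (x, t) ∈ tCond ∧ paramEnc (x, t) ∈ M₁) ↔ _
    rw [hlenCond_iff, htCond_iff]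
  -- the small yes-instances
  set Fsmall : Set (List Bool) := {v | v.length < nb ∧ v ∈ (U.compressionProblem L p).yes} with hFsmall
  classical
  set g : List Bool → List Bool := fun v => if v.length < nb then [decide (v ∈ Fsmall)] else encodeBool (Lmain.boolIndicator v)
    with hg
  have hgFP : g ∈ FP := by
    refine mem_FP_of_eqOn_le (indicatorFn_mem_FP hLmainP) nb fun v hv => ?_
    simp only [hg, if_neg (not_lt.2 hv)]
  set Lstar : Language Bool := {v | g v = [true]} with hLstar
  have hLstarP : Lstar ∈ Classes.P := by
    refine mem_P_of_mem_FP hgFP Lstar fun v => ⟨fun hv => hv, fun hv => ?_⟩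
    simp only [hLstar] at hv
    change ¬ g v = [true] at hv
    simp only [hg] at hv ⊢
    split_ifs at hv ⊢ with hlt
    · simpa using hv
    · cases hb : Lmain.boolIndicator v
      · rfl
      · exact absurd (by rw [hb]; rfl) hv
  have hLstar_iff_small : ∀ v, v.length < nb → (v ∈ Lstar ↔ v ∈ Fsmall) := fun v hv => by
    change g v = [true] ↔ _
    simp only [hg, if_pos hv, List.cons.injEq, and_true, decide_eq_true_eq]
  have hLstar_iff_large : ∀ v, nb ≤ v.length → (v ∈ Lstar ↔ v ∈ Lmain) := fun v hv => by
    change g v = [true] ↔ _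
    simp only [hg, if_neg (not_lt.2 hv)]
    constructor
    · intro h
      by_contra hnot
      rw [(Set.notMem_iff_boolIndicator _ _).1 hnot] at h
      exact absurd h (by decide)
    · intro h; rw [(Set.mem_iff_boolIndicator _ _).1 h]; rfl
  -- instances of length `≥ nb` have `t ≥ T₀` when `|x| ≤ p_L(t)`
  have hlarge_t : ∀ (x : List Bool) (t : ℕ), x.length ≤ pL.eval t → nb ≤ (paramEnc (x, t)).length → T₀ ≤ t := by
    intro x t hx hlen
    by_contra hlt
    push Not at hlt
    have h1 : pL.eval t ≤ pL.eval T₀ := LCBounds.eval_mono pL hlt.le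
    simp only [paramEnc, length_boolPair, ParamUniform.length_unaryEncodeNat] at hlen
    omega
  refine ⟨Lstar, hLstarP, ?_, ?_⟩
  · -- yes-instances are accepted
    rintro v ⟨x, t, rfl, hx⟩
    by_cases hsmall : (paramEnc (x, t)).length < nb
    · exact (hLstar_iff_small _ hsmall).2 ⟨hsmall, x, t, rfl, hx⟩
    · push Not at hsmall
      have hxlen : x.length ≤ pL.eval t := hpL t x hx
      have ht : T₀ ≤ t := hlarge_t x t hxlen hsmall
      exact (hLstar_iff_large _ hsmall).2 ((hLmain_iff x t).2 ⟨hxlen, ht, hyesM ⟨x, t, rfl, ht, hx⟩⟩)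
  · -- no-instances are rejected
    rintro v ⟨x, t, rfl, hno⟩ hv
    change paramEnc (x, t) ∈ Lstar at hv
    by_cases hsmall : (paramEnc (x, t)).length < nb
    · -- a small accepted instance is a small yes-instance, whose `K^{p(t)}` is below `log p(t)`
      obtain ⟨-, hyes⟩ := (hLstar_iff_small _ hsmall).1 hv
      have hx : x ∈ languageSlice L t := (U.paramEnc_mem_compressionProblem_yes_iff L p).1 hyes
      have hxlen : x.length < nb := by
        simp only [paramEnc, length_boolPair, ParamUniform.length_unaryEncodeNat] at hsmall; omega
      have hK : U.ktAt (p t) x ≤ ((Nat.log 2 (languageSlice L t).ncard + Nat.log 2 (p t) : ℕ) : ℕ∞) :=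
        calc U.ktAt (p t) x ≤ U.ktAt c₀ x := U.ktAt_anti (hp_ge_c₀ t) x
          _ ≤ x.length + a₀ := hsmallK x c₀ le_rfl
          _ ≤ ((Nat.log 2 (languageSlice L t).ncard + Nat.log 2 (p t) : ℕ) : ℕ∞) := by
            have h1 := hlogp t
            have h2 : x.length + a₀ ≤ Cb := by rw [hCb]; omega
            exact_mod_cast (by omega)
      exact absurd hno (not_lt.2 (by simpa [hp] using hK))
    · push Not at hsmall
      obtain ⟨hxlen, ht, hM⟩ := (hLmain_iff x t).1 ((hLstar_iff_large _ hsmall).1 hv)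
      exact hnoM ⟨x, t, rfl, ht, hxlen, by simpa [hp] using hno⟩ hM

end LCAssembly

end Literature.Computability.MetaComplexity
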